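import Summits.ResolutionOfSingularities.ResolutionOfSingularities.Theorems.PurelyInseparableDim4WinCertAllFields
import HarnessLib
import HarnessLib.Audit.Tags

/-!
# Purely inseparable fourfolds — IN-SCOPE win certificates valid over EVERY field of characteristic `p`
# (monomial-curve BLINDNESS leaves go up along the coefficient map; sequel of `…WinCertAllFields`)
# [OURS · counted 0 · a certificate format for OUR frame v4, not about resolution]

Census cell «res-dim4-pi» (D-0157 DOOR 2), width seat `res-dim4-p-14` (generation 2).  `…WinCertAllFields`
(`uwinCertB`, `stateWins_map_of_uwinCertB`) upgrades FULL-game `𝔽_p` certificates whose rows are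
rationality-forced to EVERY field of characteristic `p`; res-dim4-p-13's band certificates (`…BandWin1–14`, p-14's
PR-12u format `ICert`) are IN-SCOPE certificates whose leaves are BLIND states certified by monomial curves
(`ScopeBlind.blindB`) or rational curves.  This file adds what those need:

* **`not_inCoordinateScope_map_of_blindB`** — a monomial-curve blindness certificate over `k` proves blindness of
  the base-changed state over every `K ⊇ k` (`curveHom_map`: the curve `xᵢ = cᵢ t^{wᵢ}` commutes with the coefficient
  map; then p-3's `IsolationCert.not_inCoordinateScope_of_ringHom` over `K` with the mapped witness point);
* the format `UICert k = List (IRow k × List (RatWit k))` (PR-12u rows + rationality witnesses) with checker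
  `uiwinCertB p q` (`uirowOK`: a `.mono` blindness certificate, or a non-`q`-fold origin, or PR-12u's move check over `k`
  together with `WinCertAllFields.ratOK`), `iwinCertB_of_uiwinCertB` (the `𝔽_p` certificate is inside);
* **`inScopeStateWins_map_of_uiwinCertB`**: for `T : UICert (ZMod p)` passing the checker, every field `K` of
  characteristic `p` and `f : ZMod p →+* K`, every row state `⊗ K` is IN-SCOPE ESCAPABLE (`InScopeStateWins q`, the
  F4-C game of record `Edge`, player B over ALL of `K⁴`); `forall_inScopeStateWins_of_uiwinCertB` (`ZMod.castHom`).
* ACCEPTANCE (`decide`, `p = q = 2`): PR-12u's SCOPE-LOSS certificate (`x₁³x₂ + x₁³x₃x₄`, forced divisor, four blind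
  children) with witnesses ⇒ in-scope escapable over EVERY field of characteristic 2 (`forall_inScopeStateWins_scopeLossU`).
  MEASURED (seat instrument): 684 of the 1,059 roots of p-13's `BandWin1–14` have every reachable A-row
  rationality-forced and meet only `.mono` leaves — batches follow in separate files.

NOT here: `.rat`/normalised-rational leaves (a power-series transfer; none is needed by the measured roots).  Nothing
here proves resolution of singularities in dimension ≥ 4 / characteristic `p`; counted 0; AI work, weaker than expert
review.  bears_on: LADDER-RESOLUTION:D157-DOOR2 (res-dim4-pi · F4-C instrument · ∀K gap).
Supports stmt-ResolutionOfSingularities-16155 (helper).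
-/

set_option linter.dupNamespace false

noncomputable section
open MvPolynomial Finset
open scoped BigOperators
namespace Summit.ResolutionOfSingularities.ResolutionOfSingularities.Theorems.PIDim4

namespace WinCertAllFields

open Literature.AlgebraicGeometry.Resolution
open Literature.AlgebraicGeometry.Resolution.CentreBlowup
open StepKit WinCertSound InScopeWinCert ScopeCover ScopeBlind

variable {k : Type} [Field k] [DecidableEq k]

/-! ## 1. Monomial-curve blindness certificates go up -/

omit [DecidableEq k] in
/-- The monomial curve commutes with the coefficient map: `curve_{f∘c,w} ∘ (⊗K) = (⊗K) ∘ curve_{c,w}`. [folklore] -/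
theorem curveHom_map {K : Type} [Field K] (f : k →+* K) (c : Fin 4 → k) (w : Fin 4 → ℕ)
    (P : MvPolynomial (Fin 4) k) :
    curveHom (f ∘ c) w (MvPolynomial.map f P) = MvPolynomial.map f (curveHom c w P) := by
  have h : ((curveHom (f ∘ c) w).toRingHom.comp (MvPolynomial.map f)) =
      (MvPolynomial.map f).comp (curveHom c w).toRingHom := by
    refine MvPolynomial.ringHom_ext (fun r => ?_) (fun i => ?_)
    · simp only [RingHom.comp_apply, AlgHom.toRingHom_eq_coe, AlgHom.coe_toRingHom, map_C]
      rw [curveHom, curveHom, MvPolynomial.algHom_C, MvPolynomial.algHom_C, MvPolynomial.algebraMap_eq,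
        MvPolynomial.algebraMap_eq, map_C]
    · simp only [RingHom.comp_apply, AlgHom.toRingHom_eq_coe, AlgHom.coe_toRingHom, map_X]
      rw [curveHom, curveHom, MvPolynomial.aeval_X, MvPolynomial.aeval_X, map_monomial, Function.comp_apply]
  exact congrArg (fun φ : MvPolynomial (Fin 4) k →+* MvPolynomial (Fin 1) K => φ P) h

omit [DecidableEq k] in
/-- Evaluation at a mapped point of a mapped polynomial. [folklore] -/
theorem eval_comp_map {K : Type} [Field K] (f : k →+* K) (a : Fin 4 → k) (P : MvPolynomial (Fin 4) k) :
    MvPolynomial.eval (f ∘ a) (MvPolynomial.map f P) = f (MvPolynomial.eval a P) := by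
  rw [eval_map, ← coe_eval₂Hom]
  have h : (eval₂Hom f (f ∘ a)) = f.comp (eval₂Hom (RingHom.id k) a) := by
    refine MvPolynomial.ringHom_ext (fun r => ?_) (fun i => ?_)
    · simp
    · simp
  rw [h]
  rfl

/-- **A monomial-curve blindness certificate over `k` certifies blindness over every `K ⊇ k`.** [folklore] -/
theorem not_inCoordinateScope_map_of_blindB {K : Type} [Field K] [DecidableEq K] (f : k →+* K) {q : ℕ}
    {s : SData 4 k} {c : Fin 4 → k} {w : Fin 4 → ℕ} {α₀ : Fin 4 → ℕ} {a : Fin 4 → k}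
    (h : blindB q s c w α₀ a = true) : ¬ InCoordinateScope q (MvPolynomial.map f (evalT s.L)) := by
  simp only [blindB, Bool.and_eq_true, decide_eq_true_eq, List.all_eq_true, Bool.not_eq_true',
    decide_eq_false_iff_not] at h
  obtain ⟨⟨⟨⟨hw, hJ⟩, ha⟩, hα₀⟩, hne⟩ := h
  have hdeg : (expo α₀).degree = ∑ i, α₀ i := degree_expo α₀
  have hw' : ∀ i, (f ∘ c) i = 0 ∨ 1 ≤ w i := fun i => by
    rcases hw i with h0 | h1
    · exact Or.inl (by rw [Function.comp_apply, h0, map_zero])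
    · exact Or.inr h1
  refine IsolationCert.not_inCoordinateScope_of_ringHom (curveHom (f ∘ c) w).toRingHom (fun α h0 hq => ?_)
    (eval_zero_of_curveHom_eq_zero hw') (Finset.univ.filter fun i => (f ∘ c) i = 0) (fun i hi => ?_)
    (expo α₀) (by rw [hdeg]; exact hα₀.1) (by rw [hdeg]; exact hα₀.2) (f ∘ a) (fun i hi => ?_) ?_
  · change curveHom (f ∘ c) w (hasseDeriv α (MvPolynomial.map f (evalT s.L))) = 0
    rw [IsolationConverse.hasseDeriv_map, curveHom_map, ← expo_coe α, hasseDeriv_evalT, aeval_curve_evalT,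
      (evalT_eq_zero_iff _).mpr (hJ (⇑α) (mem_idxLT h0 hq)), map_zero]
  · change curveHom (f ∘ c) w (X i) ≠ 0
    have hci : (f ∘ c) i ≠ 0 := by simpa using hi
    rw [curveHom, MvPolynomial.aeval_X]
    exact (monomial_eq_zero).not.mpr hci
  · have hci : c i = 0 := by
      have : (f ∘ c) i = 0 := by simpa using hi
      exact (map_eq_zero_iff f f.injective).mp this
    rw [Function.comp_apply, ha i hci, map_zero]
  · rw [IsolationConverse.hasseDeriv_map, eval_comp_map, hasseDeriv_evalT, eval_evalT]
    exact (map_ne_zero_iff f f.injective).mpr hne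

/-! ## 2. In-scope certificates with rationality witnesses -/

/-- A row: PR-12u's `(presented state, A's centre, blindness certificate?)` plus rationality witnesses. [folklore] -/
abbrev UIRow (k : Type) : Type := IRow k × List (RatWit k)
/-- A certificate: rows, children LATER in the list. [folklore] -/
abbrev UICert (k : Type) : Type := List (UIRow k)

/-- A `.mono` blindness certificate of the row passes (only monomial curves are transferred here). [folklore] -/
def monoBlindOK (q : ℕ) (row : UIRow k) : Bool :=
  match row.1.2.2 with
  | some (.mono c w α₀ a) => blindB q row.1.1 c w α₀ a
  | _ => false

variable [Fintype k]

/-- The row check: a monomial-curve BLIND leaf, or origin not `q`-fold, or (PR-12u's move check over `k` — permissible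
centre, every `k`-rational reply harmless — and the rationality check of `…WinCertAllFields`). [folklore] -/
def uirowOK (p q : ℕ) (rest : UICert k) (row : UIRow k) : Bool :=
  monoBlindOK q row || !(permB q Finset.univ row.1.1.L) ||
    ((permB q row.1.2.1 row.1.1.L &&
      decide (∀ j ∈ row.1.2.1, ∀ b : Fin 4 → k, b j = 0 →
        ireplyOK q (rest.map Prod.fst) row.1.1 row.1.2.1 j b = true)) &&
      ratOK p q ((row.1.1, row.1.2.1), row.2))

/-- **The checker.** [folklore] -/
def uiwinCertB (p q : ℕ) : UICert k → Bool
  | [] => true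
  | row :: rest => uirowOK p q rest row && uiwinCertB p q rest

/-- A passing row passes PR-12u's row check. [folklore] -/
theorem irowOK_of_uirowOK {p q : ℕ} {rest : UICert k} {row : UIRow k} (h : uirowOK p q rest row = true) :
    irowOK q (rest.map Prod.fst) row.1 = true := by
  unfold uirowOK at h
  unfold irowOK blindOK
  rw [Bool.or_eq_true, Bool.or_eq_true, Bool.and_eq_true] at h
  rw [Bool.or_eq_true, Bool.or_eq_true]
  rcases h with (hb | ht) | ⟨hm, -⟩
  · refine Or.inl (Or.inl ?_)
    unfold monoBlindOK at hb
    obtain ⟨⟨s, S, oβ⟩, ws⟩ := row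
    rcases oβ with _ | ⟨c, w, α₀, a⟩ | ⟨P, v, D, kk, α₀, a⟩
    · exact absurd hb Bool.false_ne_true
    · exact hb
    · exact absurd hb Bool.false_ne_true
  · exact Or.inl (Or.inr ht)
  · exact Or.inr hm

/-- **The `𝔽_p` certificate is inside.** [folklore] -/
theorem iwinCertB_of_uiwinCertB {p q : ℕ} :
    ∀ {T : UICert k}, uiwinCertB p q T = true → iwinCertB q (T.map Prod.fst) = true
  | [], _ => rfl
  | row :: rest, h => by
    unfold uiwinCertB at h
    rw [Bool.and_eq_true] at h
    rw [List.map_cons]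
    unfold iwinCertB
    rw [Bool.and_eq_true]
    exact ⟨irowOK_of_uirowOK h.1, iwinCertB_of_uiwinCertB h.2⟩

/-! ## 3. Soundness over every field of characteristic `p` -/

/-- **SOUNDNESS of one row over `K`.** [folklore] -/
theorem inScopeStateWins_map_of_uirowOK {p : ℕ} [Fact p.Prime] {q : ℕ} {K : Type} [Field K] [CharP K p]
    [DecidableEq K] (f : ZMod p →+* K) {rest : UICert (ZMod p)}
    (hrest : ∀ r ∈ rest, InScopeStateWins q
      (⟨MvPolynomial.map f r.1.1.toState.F, r.1.1.toState.r, r.1.1.toState.exc⟩ : State K))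
    {row : UIRow (ZMod p)} (h : uirowOK p q rest row = true) :
    InScopeStateWins q
      (⟨MvPolynomial.map f row.1.1.toState.F, row.1.1.toState.r, row.1.1.toState.exc⟩ : State K) := by
  unfold uirowOK at h
  rw [Bool.or_eq_true, Bool.or_eq_true] at h
  rcases h with (hb | ht) | hm
  · -- a monomial-curve blindness certificate: blind over `K` as well
    unfold monoBlindOK at hb
    obtain ⟨⟨s, S, oβ⟩, ws⟩ := row
    rcases oβ with _ | ⟨c, w, α₀, a⟩ | ⟨P, v, D, kk, α₀, a⟩
    · exact absurd hb Bool.false_ne_true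
    · exact inScopeStateWins_of_not_inCoordinateScope (not_inCoordinateScope_map_of_blindB f hb)
    · exact absurd hb Bool.false_ne_true
  · -- origin not `q`-fold
    rw [Bool.not_eq_true'] at ht
    refine inScopeStateWins_of_no_permissible fun S hS => ?_
    exact no_permissible_of_not_permB ht S ((BaseChange.isPermissibleCentre_map_iff f q S _).mp hS)
  · rw [Bool.and_eq_true, Bool.and_eq_true, decide_eq_true_eq] at hm
    obtain ⟨⟨hS, hall⟩, hrat⟩ := hm
    have hperm : IsPermissibleCentre q row.1.2.1 row.1.1.toState.F :=
      (isPermissibleCentre_iff q row.1.2.1 row.1.1.L).mpr hS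
    refine inScopeStateWins_move row.1.2.1 ((BaseChange.isPermissibleCentre_map_iff f q row.1.2.1 _).mpr hperm) ?_
    rintro s' ⟨j, b, hj, hbj, heq, hne, rfl⟩
    obtain ⟨b₀, hb₀j, rfl⟩ :=
      exists_rational_of_ratOK f (row := ((row.1.1, row.1.2.1), row.2)) hrat hj hbj heq
    have heq₀ : IsEquimultiplePoint q row.1.2.1 j b₀ row.1.1.toState :=
      (BaseChange.isEquimultiplePoint_map_ringHom_iff f q row.1.2.1 j b₀ row.1.1.toState).mp heq
    have hstep := BaseChange.step_map f q row.1.2.1 j b₀ row.1.1.toState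
    have h := hall j hj b₀ hb₀j
    unfold ireplyOK at h
    rw [Bool.or_eq_true, Bool.or_eq_true] at h
    rcases h with (h1 | h2) | h3
    · rw [Bool.not_eq_true', ← Bool.not_eq_true] at h1
      exact absurd ((isEquimultiplePoint_iff q row.1.2.1 j b₀ row.1.1).mp heq₀) h1
    · exfalso
      apply hne
      rw [hstep]
      show MvPolynomial.map f (step q row.1.2.1 j b₀ row.1.1.toState).F = 0
      have hz : (step q row.1.2.1 j b₀ row.1.1.toState).F = 0 := by
        by_contra hnz
        have := (step_F_ne_zero_iff q row.1.2.1 j b₀ row.1.1).mp hnz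
        rw [h2] at this
        exact Bool.noConfusion this
      rw [hz, map_zero]
    · obtain ⟨r, hr, hrc⟩ := exists_of_ichildIn h3
      obtain ⟨ur, hur, rfl⟩ := List.mem_map.mp hr
      rw [hstep, step_toState, hrc]
      exact hrest ur hur

/-- **SOUNDNESS OVER EVERY FIELD OF CHARACTERISTIC `p` (in-scope game)**: every row state `⊗ K` of a checked
certificate is IN-SCOPE ESCAPABLE over `K`, player B ranging over all `K`-rational chart points. [folklore] -/
theorem inScopeStateWins_map_of_uiwinCertB {p : ℕ} [Fact p.Prime] {q : ℕ} {K : Type} [Field K] [CharP K p]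
    [DecidableEq K] (f : ZMod p →+* K) :
    ∀ {T : UICert (ZMod p)}, uiwinCertB p q T = true →
      ∀ row ∈ T, InScopeStateWins q
        (⟨MvPolynomial.map f row.1.1.toState.F, row.1.1.toState.r, row.1.1.toState.exc⟩ : State K)
  | [], _ => fun row hrow => absurd hrow List.not_mem_nil
  | row :: rest, h => by
    unfold uiwinCertB at h
    rw [Bool.and_eq_true] at h
    have hrest := inScopeStateWins_map_of_uiwinCertB f h.2
    intro r hr
    rcases List.mem_cons.mp hr with rfl | hr'
    · exact inScopeStateWins_map_of_uirowOK f hrest h.1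
    · exact hrest r hr'

/-- **`∀ K` form** (coefficient map `ZMod.castHom`). [folklore] -/
theorem forall_inScopeStateWins_of_uiwinCertB {p : ℕ} [Fact p.Prime] {q : ℕ} {T : UICert (ZMod p)}
    (h : uiwinCertB p q T = true) (K : Type) [Field K] [CharP K p] [DecidableEq K] :
    ∀ row ∈ T, InScopeStateWins q
      (⟨MvPolynomial.map (ZMod.castHom (dvd_refl p) K) row.1.1.toState.F, row.1.1.toState.r,
        row.1.1.toState.exc⟩ : State K) :=
  inScopeStateWins_map_of_uiwinCertB (ZMod.castHom (dvd_refl p) K) h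

/-! ## 4. Acceptance over every field of characteristic 2: PR-12u's SCOPE-LOSS certificate -/

/-- Acceptance specimen: the BLIND CHILD `x₁(x₂ + x₃x₄)` (`r = (1,0,0,0)`, `exc = {x₁}`) of PR-12u's scope-loss
certificate, as a one-row certificate with its monomial-curve blindness certificate and no witnesses needed.  (The
scope-loss ROOT `x₁³(x₂ + x₃x₄)` itself is NOT rationality-forced: in its chart `x₁` the equimultiple locus is
`b₂ = b₃b₄`, which has non-rational points over `𝔽₄` — there the rider is genuine.) [folklore] -/
def scopeLossChildU : UICert (ZMod 2) :=
  [((⟨[(![1, 1, 0, 0], 1), (![1, 0, 1, 1], 1)], ![1, 0, 0, 0], {0}⟩, ∅,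
      some (.mono ![0, 1, 1, 1] ![0, 2, 1, 1] ![1, 0, 0, 0] ![0, 1, 0, 0])), [])]

/-- The one-row certificate checks (`p = q = 2`). [folklore] -/
theorem uiwinCertB_scopeLossChildU : uiwinCertB 2 2 scopeLossChildU = true := by
  decide

/-- **Over EVERY field `K` of characteristic 2 the scope-loss child `x₁(x₂ + x₃x₄)` (with `r = (1,0,0,0)`,
`exc = {x₁}`) is in-scope escapable — indeed BLIND — in the F4-C game over `K`.** [OURS · ‖ K] [folklore] -/
theorem forall_inScopeStateWins_scopeLossChildU (K : Type) [Field K] [CharP K 2] [DecidableEq K] :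
    ∀ row ∈ scopeLossChildU, InScopeStateWins 2
      (⟨MvPolynomial.map (ZMod.castHom (dvd_refl 2) K) row.1.1.toState.F, row.1.1.toState.r,
        row.1.1.toState.exc⟩ : State K) :=
  forall_inScopeStateWins_of_uiwinCertB uiwinCertB_scopeLossChildU K

end WinCertAllFields

end Summit.ResolutionOfSingularities.ResolutionOfSingularities.Theorems.PIDim4

end
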